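import Summits.QuantumAdvantage.QuantumAdvantage.Theorems.AnchorDialAnchored
import Summits.QuantumAdvantage.QuantumAdvantage.Theorems.AnchorDialTable
import Summits.QuantumAdvantage.AdviceFreeQNC0.WindowLocalHard

/-!
# AnchorDial — part 15/16 «Window» (cell decomp-qadv, seat lens-2, generation 14 rev 8; supports item 26531 `ExactnessDial.PolyLossOddU3`)

§12i of the node (rev 8), first half: THE WINDOW LAW.  Walk algebra at `x` alone — `wpar` / `zpar_window` / `wpar_local`
(parities inside a window after the anchor = hidden entrance parity XOR a VISIBLE window parity), **`cN_window`**
(`c_{k+j} = c_k + j + #{1 ≤ i ≤ j : zpar x (k+i)}`), **`gCond_window`** (kernel bit at `k+j` = «`c_k` avoids `wval x k j`»,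
reflected under odd entrance parity) — makes a one-point deviation anywhere in `[k(x), k(x)+r]` a TABLE CERTIFICATE (part 14)
with value polynomial `gW` of degree `2·deg + 2 + r` (`devA_apply`, `mem_lowDeg_of_dependsOn3`, `wval_mem`, `gW_mem`,
`gW_apply_uni`, **`cwt_gW_iff`**, `deg_bump_window`); hence **`windowDev_loss r c`**: the law at strategy level for EVERY
window width `r` (constant `1/49`, `n ≥ max n₀ 2^{r+4}`; part 13's `anchoredDev_loss` is width `1`).  Verbatim from the node
file (rev 8); namespace `…Theorems.AnchorDial`; imports parts 13, 14 and `AdviceFreeQNC0.WindowLocalHard`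
(`ind_mem_lowDeg_of_dependsOn`); joint check `tree/Chain16.check.lean`; record NODE-g14.md §REV 8.
-/

set_option linter.dupNamespace false
set_option linter.unusedVariables false

noncomputable section

open scoped Classical

namespace Summit.QuantumAdvantage.QuantumAdvantage.Theorems.AnchorDial

open Finset
open Literature.Computability.QuantumComplexity Literature.Computability.QuantumComplexity.RingHLF
open Literature.Computability.MetaComplexity Literature.Computability.MetaComplexity.Smolensky
open Summit.QuantumAdvantage.AdviceFreeQNC0
open Summit.QuantumAdvantage.QuantumAdvantage.Theses (ExactnessDial.PolyLossOddU3 ExactnessDial.DPLift3)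
open Summit.QuantumAdvantage.QuantumAdvantage.Theorems.HolonomyDial (gCond tPoly tPoly_mem tPoly_apply selP selP_mem
  selP_apply xorP xorP_mem xorP_apply_bool closes_T)

variable {N : ℕ}

/-! ## §12i  THE WINDOW LAW (rev 8): one deviation anywhere in a window after a stable unique anchor

`anchoredDev_loss` (§12g) covers a deviation AT the anchor or ONE step after it, and `anchoredDev_loss_needs_degree`
(§12h) shows the degree hypothesis is essential already there.  The table engine (§11b) now yields the law for EVERY
window width `r`: the deviation point `p(x)` may sit anywhere in `[k(x), k(x) + r]` (non-wrapping), `r` fixed but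
arbitrary — the only cost is the degree bump `2·deg + 2 + r ≤ (log₂ n)^{c+1}`, i.e. `n ≥ 2^{r+4}`.  On such inputs
«`x` wins» IS the table certificate with the WINDOW VALUE POLYNOMIAL `gW P r k = Σ_{k ≤ q ≤ k+r} devA P q · wval(k, q-k)`,
`wval x k j = 2 - j - #{1 ≤ i ≤ j : wpar x k i}`: walk algebra AT `x` ALONE (`cN_window`:
`c_{k+j} = c_k + j + Σ_{1 ≤ i ≤ j} [zpar x (k+i)]`; `zpar_window`: `zpar x (k+i) = zpar x (k+1) ⊕ wpar x k i`, the window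
parity `wpar` being VISIBLE and of degree `< j`, `wpar_local`), and the reflection law `a(ū) = 1 - a(u)` holds at every
offset (`gCond_window`).  So the discharged special class widens from «±1 jitter» (rev 7) to «width-`r` window jitter
for every `r`» — it now contains the `MOD₃`-steered 2-jitter strategy of the §6 barrier notes — and the typed residual
shrinks to `NoWindowAnchorLoss3 ≡ T` (`polyLossOddU3_iff_noWindowAnchorLoss3`). -/
section Window

/-- window parity relative to the anchor: `zpar x (k+i) ⊕ zpar x (k+1)` = parity of the zeros of `x` on positions
`k+1, …, k+i-1` (visible on the window when `1 ≤ i` and `k + i ≤ N`: `wpar_local`). -/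
def wpar (x : Fin N → Bool) (k i : ℕ) : Bool := xor (zpar x (k + i)) (zpar x (k + 1))

/-- AnchorDialWindow helper `zpar_window` (decomp-qadv land package; see the module docstring). -/
theorem zpar_window (x : Fin N → Bool) (k i : ℕ) : zpar x (k + i) = xor (zpar x (k + 1)) (wpar x k i) := by
  unfold wpar
  cases zpar x (k + i) <;> cases zpar x (k + 1) <;> rfl

/-- AnchorDialWindow helper `wpar_one` (decomp-qadv land package; see the module docstring). -/
theorem wpar_one (x : Fin N → Bool) (k : ℕ) : wpar x k 1 = false := by
  unfold wpar
  exact Bool.xor_self _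

/-- AnchorDialWindow helper `wpar_succ` (decomp-qadv land package; see the module docstring). -/
theorem wpar_succ (x : Fin N → Bool) (k i : ℕ) (h : k + i < N) :
    wpar x k (i + 1) = xor (wpar x k i) (!x ⟨k + i, h⟩) := by
  unfold wpar
  rw [show k + (i + 1) = (k + i) + 1 by omega, zpar_succ x h]
  cases zpar x (k + i) <;> cases zpar x (k + 1) <;> cases x ⟨k + i, h⟩ <;> rfl

/-- locality: for `1 ≤ i` and `k + i ≤ N`, `wpar · k i` depends only on the coordinates in `[k+1, k+i)`. -/
theorem wpar_local (k : ℕ) : ∀ i : ℕ, 1 ≤ i → k + i ≤ N → ∀ u v : Fin N → Bool,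
    (∀ q : Fin N, k + 1 ≤ q.val → q.val < k + i → u q = v q) → wpar u k i = wpar v k i := by
  intro i
  induction i with
  | zero => intro h; omega
  | succ i ih =>
    intro _ hki u v huv
    rcases Nat.eq_zero_or_pos i with hi | hi
    · subst hi
      rw [wpar_one, wpar_one]
    · have hlt : k + i < N := by omega
      rw [wpar_succ u k i hlt, wpar_succ v k i hlt,
        ih hi (by omega) u v (fun q h1 h2 => huv q h1 (by omega)),
        huv ⟨k + i, hlt⟩ (by show k + 1 ≤ k + i; omega) (by show k + i < k + (i + 1); omega)]

/-- the visible window count `#{1 ≤ i ≤ j : wpar x k i}` and the AVOID VALUE `2 - j - count`. -/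
def wcnt (x : Fin N → Bool) (k j : ℕ) : ℕ := ∑ i ∈ range j, (if wpar x k (i + 1) = true then 1 else 0)

/-- AnchorDialWindow helper `wval` (decomp-qadv land package; see the module docstring). -/
def wval (x : Fin N → Bool) (k j : ℕ) : ZMod 3 := 2 - (j : ZMod 3) - (wcnt x k j : ZMod 3)

/-- AnchorDialWindow helper `wcnt_local` (decomp-qadv land package; see the module docstring). -/
theorem wcnt_local (k j : ℕ) (hkj : k + j ≤ N) (u v : Fin N → Bool)
    (huv : ∀ q : Fin N, k + 1 ≤ q.val → q.val < k + j → u q = v q) : wcnt u k j = wcnt v k j := by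
  unfold wcnt
  refine Finset.sum_congr rfl fun i hi => ?_
  rw [mem_range] at hi
  rw [wpar_local k (i + 1) (by omega) (by omega) u v (fun q h1 h2 => huv q h1 (by omega))]

/-- **walk algebra on the window**: `c_{k+j}(x) = c_k(x) + j + #{1 ≤ i ≤ j : zpar x (k+i)}`. -/
theorem cN_window (x : Fin N → Bool) (k : ℕ) : ∀ j : ℕ, k + j ≤ N →
    cN x (k + j) = cN x k + j + ∑ i ∈ range j, (if zpar x (k + (i + 1)) = true then 1 else 0) := by
  intro j
  induction j with
  | zero => intro _; simp
  | succ j ih =>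
    intro hkj
    rw [show k + (j + 1) = (k + j) + 1 by omega, cN_succ x (k + j) (by omega), ih (by omega)]
    simp only [Finset.sum_range_succ]
    rw [show k + j + 1 = k + (j + 1) from rfl]
    omega

/-- AnchorDialWindow helper `sum_zpar_false` (decomp-qadv land package; see the module docstring). -/
theorem sum_zpar_false (x : Fin N → Bool) (k j : ℕ) (hu : zpar x (k + 1) = false) :
    (∑ i ∈ range j, (if zpar x (k + (i + 1)) = true then 1 else 0 : ℕ)) = wcnt x k j := by
  unfold wcnt
  refine Finset.sum_congr rfl fun i _ => ?_
  rw [zpar_window x k (i + 1), hu, Bool.false_xor]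

/-- AnchorDialWindow helper `sum_zpar_true` (decomp-qadv land package; see the module docstring). -/
theorem sum_zpar_true (x : Fin N → Bool) (k j : ℕ) (hu : zpar x (k + 1) = true) :
    (∑ i ∈ range j, (if zpar x (k + (i + 1)) = true then 1 else 0 : ℕ)) + wcnt x k j = j := by
  unfold wcnt
  have h : ∀ i ∈ range j, ((if zpar x (k + (i + 1)) = true then 1 else 0 : ℕ) +
      (if wpar x k (i + 1) = true then 1 else 0)) = 1 := by
    intro i _
    rw [zpar_window x k (i + 1), hu, Bool.true_xor]
    cases wpar x k (i + 1) <;> simp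
  rw [← Finset.sum_add_distrib, Finset.sum_congr rfl h]
  simp

/-- **the certificate form of a window bet, by walk algebra at `x` alone**: the kernel bit at `k + j` is `1` iff the
phase `c_k(x)` avoids `wval x k j` — reflected `a ↦ 1 - a` under odd entrance parity `zpar x (k+1)`. -/
theorem gCond_window (x : Fin N → Bool) (k j : ℕ) (hkj : k + j < N) :
    gCond x (k + j) ↔ ((cN x k : ℕ) : ZMod 3) ≠
      (if zpar x (k + 1) = true then 1 - wval x k j else wval x k j) := by
  rw [gCond_iff_cN, mod3_ne_two_iff, cN_window x k j hkj.le]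
  set s := (∑ i ∈ range j, (if zpar x (k + (i + 1)) = true then 1 else 0 : ℕ)) with hs_def
  have key₁ : ∀ a w jj : ZMod 3, (a + jj + w ≠ 2 ↔ a ≠ 2 - jj - w) := by decide
  have key₂ : ∀ a w jj : ZMod 3, (a + jj + (jj - w) ≠ 2 ↔ a ≠ 1 - (2 - jj - w)) := by decide
  unfold wval
  by_cases hu : zpar x (k + 1) = true
  · rw [if_pos hu]
    have hs : s + wcnt x k j = j := sum_zpar_true x k j hu
    have hc : (s : ZMod 3) = (j : ZMod 3) - (wcnt x k j : ZMod 3) := by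
      rw [eq_sub_iff_add_eq, ← Nat.cast_add, hs]
    push_cast
    rw [hc]
    exact key₂ _ _ _
  · rw [if_neg hu]
    have hs : s = wcnt x k j := sum_zpar_false x k j (by simpa using hu)
    push_cast
    rw [hs]
    exact key₁ _ _ _

/-- pointwise value of the deviation indicator. -/
theorem devA_apply (P : Fin N → CubeFn (ZMod 3) N) (k : Fin N) (x : Fin N → Bool) :
    devA P k x = if k ∈ dev P x then 1 else 0 := by
  have hs : selP (P k) x = if decide (P k x = 1) then 1 else 0 := by
    rw [selP_apply]; by_cases hq : P k x = 1 <;> simp [hq]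
  have h := xorP_apply_bool (selP (P k)) (tPoly k) x (decide (P k x = 1)) (tGuess x k) hs (tPoly_apply k x)
  have hm : (k ∈ dev P x) ↔ (decide (P k x = 1) ≠ tGuess x k) := by
    rw [dev, mem_filter]
    simp only [mem_univ, true_and]
  rw [devA, h]
  by_cases hk : k ∈ dev P x
  · rw [if_pos hk]
    have hne := hm.1 hk
    revert hne
    generalize decide (P k x = 1) = p
    generalize tGuess x k = q
    cases p <;> cases q <;> decide
  · rw [if_neg hk]
    have hne : ¬ (decide (P k x = 1) ≠ tGuess x k) := fun h' => hk (hm.2 h')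
    revert hne
    generalize decide (P k x = 1) = p
    generalize tGuess x k = q
    cases p <;> cases q <;> decide

/-- `𝔽₃`-valued functions depending on a coordinate set `S` have degree `≤ #S`. -/
theorem mem_lowDeg_of_dependsOn3 (S : Finset (Fin N)) (h : (Fin N → Bool) → ZMod 3)
    (hh : ∀ u v : Fin N → Bool, (∀ i ∈ S, u i = v i) → h u = h v) :
    (fun u => h u) ∈ lowDeg (ZMod 3) N S.card := by
  have e : (fun u => h u) = (fun u => if decide (h u = 1) = true then (1 : ZMod 3) else 0) +
      (2 : ZMod 3) • (fun u => if decide (h u = 2) = true then (1 : ZMod 3) else 0) := by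
    funext u
    simp only [Pi.add_apply, Pi.smul_apply, smul_eq_mul, decide_eq_true_eq]
    generalize h u = t
    revert t
    decide
  rw [e]
  exact Submodule.add_mem _
    (ind_mem_lowDeg_of_dependsOn (F := ZMod 3) S _ fun u v huv => by rw [hh u v huv])
    (Submodule.smul_mem _ _ (ind_mem_lowDeg_of_dependsOn (F := ZMod 3) S _ fun u v huv => by rw [hh u v huv]))

/-- AnchorDialWindow helper `wval_mem` (decomp-qadv land package; see the module docstring). -/
theorem wval_mem (k j : ℕ) (hkj : k + j ≤ N) :
    (fun x : Fin N → Bool => wval x k j) ∈ lowDeg (ZMod 3) N j := by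
  set S := (univ : Finset (Fin N)).filter fun q => k + 1 ≤ q.val ∧ q.val < k + j with hS
  have hcard : S.card ≤ j := by
    have hsub : S.map Fin.valEmbedding ⊆ Finset.Ico (k + 1) (k + j) := by
      intro m hm
      rw [Finset.mem_map] at hm
      obtain ⟨q, hq, rfl⟩ := hm
      rw [hS, mem_filter] at hq
      rw [Finset.mem_Ico]
      exact ⟨hq.2.1, hq.2.2⟩
    have h := Finset.card_le_card hsub
    rw [Finset.card_map, Nat.card_Ico] at h
    omega
  have hdep : ∀ u v : Fin N → Bool, (∀ q ∈ S, u q = v q) → wval u k j = wval v k j := by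
    intro u v huv
    unfold wval
    rw [wcnt_local k j hkj u v (fun q h1 h2 => huv q (by rw [hS, mem_filter]; exact ⟨mem_univ _, h1, h2⟩))]
  exact lowDeg_mono hcard (mem_lowDeg_of_dependsOn3 S (fun x => wval x k j) hdep)

/-- the WINDOW VALUE POLYNOMIAL over anchor `k`: `Σ_{k ≤ q ≤ k+r} devA P q · wval(k, q - k)`. -/
def gW (P : Fin N → CubeFn (ZMod 3) N) (r : ℕ) (k : Fin N) : CubeFn (ZMod 3) N :=
  ∑ q : Fin N, if k.val ≤ q.val ∧ q.val ≤ k.val + r then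
    devA P q * (fun x => wval x k.val (q.val - k.val)) else 0

/-- AnchorDialWindow helper `gW_mem` (decomp-qadv land package; see the module docstring). -/
theorem gW_mem {D : ℕ} {P : Fin N → CubeFn (ZMod 3) N} (hP : ∀ i, P i ∈ lowDeg (ZMod 3) N D) (r : ℕ)
    (k : Fin N) : gW P r k ∈ lowDeg (ZMod 3) N (((D + D) + 2) + r) := by
  unfold gW
  refine Submodule.sum_mem _ fun q _ => ?_
  by_cases hq : k.val ≤ q.val ∧ q.val ≤ k.val + r
  · rw [if_pos hq]
    have hqN := q.isLt
    exact mul_mem_lowDeg_add (devA_mem hP q)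
      (lowDeg_mono (by omega) (wval_mem k.val (q.val - k.val) (by omega)))
  · rw [if_neg hq]
    exact Submodule.zero_mem _

/-- AnchorDialWindow helper `gW_apply_uni` (decomp-qadv land package; see the module docstring). -/
theorem gW_apply_uni (P : Fin N → CubeFn (ZMod 3) N) (r : ℕ) (k : Fin N) (x : Fin N → Bool) (p : Fin N)
    (hp : dev P x = {p}) (hkp : k.val ≤ p.val) (hpk : p.val ≤ k.val + r) :
    gW P r k x = wval x k.val (p.val - k.val) := by
  unfold gW
  rw [Finset.sum_apply, Finset.sum_eq_single p]
  · rw [if_pos ⟨hkp, hpk⟩, Pi.mul_apply, devA_apply, hp, if_pos (mem_singleton_self _), one_mul]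
  · intro q _ hqp
    by_cases hq : k.val ≤ q.val ∧ q.val ≤ k.val + r
    · rw [if_pos hq, Pi.mul_apply, devA_apply, hp, if_neg (by rwa [mem_singleton]), zero_mul]
    · rw [if_neg hq]
      rfl
  · intro h
    exact absurd (mem_univ _) h

/-- **window bet = table certificate**: on an odd input with unique anchor `k` and single deviation point
`p ∈ [k, k + r]`, the strategy wins iff `CWT A (gW P r) x`. -/
theorem cwt_gW_iff (hN : 3 ≤ N) (P A : Fin N → CubeFn (ZMod 3) N) (r : ℕ) (x : Fin N → Bool)
    (hx : OddZeros x) (k : Fin N) (hk : anc A x = {k}) (p : Fin N) (hp : dev P x = {p})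
    (hkp : k.val ≤ p.val) (hpk : p.val ≤ k.val + r) : CWT A (gW P r) x ↔ Rel x (outB P x) := by
  have hrel : Rel x (outB P x) ↔ gCond x p.val := by
    rw [win_iff hN P x hx, hp, filter_singleton]
    by_cases hg : gCond x p.val
    · rw [if_pos hg, card_singleton]
      simp [hg]
    · rw [if_neg hg, card_empty]
      simp [hg]
  have hj : k.val + (p.val - k.val) = p.val := by omega
  have hwin : gCond x p.val ↔ ((cN x k.val : ℕ) : ZMod 3) ≠
      (if zpar x (k.val + 1) = true then 1 - gW P r k x else gW P r k x) := by
    rw [gW_apply_uni P r k x p hp hkp hpk,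
      ← gCond_window x k.val (p.val - k.val) (by rw [hj]; exact p.isLt), hj]
  rw [hrel, hwin]
  constructor
  · rintro ⟨k', hk', hne⟩
    rw [hk, Finset.singleton_inj] at hk'
    subst hk'
    exact hne
  · intro hne
    exact ⟨k, hk, hne⟩

/-- degree bookkeeping: `2·(log₂ n)^c + 2 + r ≤ (log₂ n)^(c+1)` once `n ≥ 2^{r+4}`. -/
theorem deg_bump_window (n c r : ℕ) (hn : 2 ^ (r + 4) ≤ n) :
    (((Nat.log 2 n) ^ c + (Nat.log 2 n) ^ c) + 2) + r ≤ (Nat.log 2 n) ^ (c + 1) := by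
  have hL : r + 4 ≤ Nat.log 2 n := Nat.le_log_of_pow_le (by norm_num) hn
  have hpos : 1 ≤ (Nat.log 2 n) ^ c := Nat.one_le_pow _ _ (by omega)
  have h1 := Nat.mul_le_mul_left ((Nat.log 2 n) ^ c) hL
  have h2 := Nat.mul_le_mul_left r hpos
  rw [pow_succ]
  nlinarith [h1, h2, hpos]

/-- **THE WINDOW LAW** (`windowDev_loss r c`, genuinely polylog, every width `r`): a degree-`(log₂ n)^c` strategy with
ONE deviation point a.e. (UNI), lying in the window `[k(x), k(x) + r]` a.e. (NEAR_r, non-wrapping) over a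
degree-`(log₂ n)^c` anchor family that is a.e. unique (UNIQ) and flip-stable on average (STAB), LOSES on at least
`2^{n-1}/49` odd inputs, `n ≥ max n₀(c+1) 2^{r+4}`.  Proof: `value_certificate_loss (c+1)` for the table certificate
`(A, gW P r)` + `cwt_gW_iff`.  `r = 1` recovers (the non-wrapping part of) `anchoredDev_loss`; by
`anchoredDev_loss_needs_degree` the degree hypothesis is necessary for every `r ≥ 1`. -/
theorem windowDev_loss (r c : ℕ) : ∃ n₀ : ℕ, ∀ n ≥ n₀, ∀ P A : Fin n → CubeFn (ZMod 3) n,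
    (∀ i, P i ∈ lowDeg (ZMod 3) n ((Nat.log 2 n) ^ c)) → (∀ k, A k ∈ lowDeg (ZMod 3) n ((Nat.log 2 n) ^ c)) →
    4096 * (univ.filter fun x : Fin n → Bool =>
        OddZeros x ∧ (univ.filter fun k : Fin n => A k x = 1).card ≠ 1).card ≤ 2 ^ (n - 1) →
    4096 * (∑ a ∈ range n, (univ.filter fun x : Fin n → Bool =>
        OddZeros x ∧ ∃ k : Fin n, ¬ ((A k (flip2 a (a + 1) x) = 1) ↔ (A k x = 1))).card) ≤ n * 2 ^ (n - 1) →
    4096 * (univ.filter fun x : Fin n → Bool => OddZeros x ∧ (dev P x).card ≠ 1).card ≤ 2 ^ (n - 1) →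
    4096 * (univ.filter fun x : Fin n → Bool => OddZeros x ∧
        ¬ ∃ k : Fin n, A k x = 1 ∧ ∀ i ∈ dev P x, k.val ≤ i.val ∧ i.val ≤ k.val + r).card ≤ 2 ^ (n - 1) →
      2 ^ (n - 1) ≤ 49 * (univ.filter fun x : Fin n → Bool =>
        OddZeros x ∧ ¬ Rel x (fun i => decide (P i x = 1))).card := by
  obtain ⟨n₀, hn₀⟩ := value_certificate_loss (c + 1)
  refine ⟨max n₀ (2 ^ (r + 4)), fun n hn P A hP hA hU hS hD hN => ?_⟩
  have hnr : 2 ^ (r + 4) ≤ n := le_trans (le_max_right _ _) hn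
  have hn16 : 16 ≤ n := by
    have h16 : (16 : ℕ) ≤ 2 ^ (r + 4) := by
      rw [show (16 : ℕ) = 2 ^ 4 by norm_num]
      exact Nat.pow_le_pow_right (by norm_num) (by omega)
    omega
  have hbump := deg_bump_window n c r hnr
  have hA' : ∀ k, A k ∈ lowDeg (ZMod 3) n ((Nat.log 2 n) ^ (c + 1)) := fun k =>
    lowDeg_mono (by omega) (hA k)
  have hg' : ∀ k, gW P r k ∈ lowDeg (ZMod 3) n ((Nat.log 2 n) ^ (c + 1)) := fun k =>
    lowDeg_mono hbump (gW_mem hP r k)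
  have key := hn₀ n (le_trans (le_max_left _ _) hn) A (gW P r) hA' hg' hU hS
  set SU := univ.filter fun x : Fin n → Bool =>
    OddZeros x ∧ (univ.filter fun k : Fin n => A k x = 1).card ≠ 1 with hSU
  set SD := univ.filter fun x : Fin n → Bool => OddZeros x ∧ (dev P x).card ≠ 1 with hSD
  set SN := univ.filter fun x : Fin n → Bool => OddZeros x ∧
    ¬ ∃ k : Fin n, A k x = 1 ∧ ∀ i ∈ dev P x, k.val ≤ i.val ∧ i.val ≤ k.val + r with hSN
  set SL := univ.filter fun x : Fin n → Bool => OddZeros x ∧ ¬ Rel x (fun i => decide (P i x = 1)) with hSL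
  have hsub : (univ.filter fun x : Fin n → Bool => OddZeros x ∧
      ¬ ∃ k : Fin n, (univ.filter fun k' : Fin n => A k' x = 1) = {k} ∧
        ((cN x k.val : ℕ) : ZMod 3) ≠ (if zpar x (k.val + 1) = true then 1 - gW P r k x else gW P r k x))
      ⊆ ((SU ∪ SD) ∪ SN) ∪ SL := by
    intro x hx
    rw [mem_filter] at hx
    obtain ⟨-, hodd, hno⟩ := hx
    by_cases h1 : (univ.filter fun k : Fin n => A k x = 1).card = 1
    swap
    · exact mem_union_left _ (mem_union_left _ (mem_union_left _ (mem_filter.2 ⟨mem_univ _, hodd, h1⟩)))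
    by_cases h2 : (dev P x).card = 1
    swap
    · exact mem_union_left _ (mem_union_left _ (mem_union_right _ (mem_filter.2 ⟨mem_univ _, hodd, h2⟩)))
    by_cases h3 : ∃ k : Fin n, A k x = 1 ∧ ∀ i ∈ dev P x, k.val ≤ i.val ∧ i.val ≤ k.val + r
    swap
    · exact mem_union_left _ (mem_union_right _ (mem_filter.2 ⟨mem_univ _, hodd, h3⟩))
    refine mem_union_right _ (mem_filter.2 ⟨mem_univ _, hodd, fun hrel => hno ?_⟩)
    obtain ⟨k₀, hk₀⟩ := card_eq_one.1 h1
    obtain ⟨p, hp⟩ := card_eq_one.1 h2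
    obtain ⟨k, hkA, hnear⟩ := h3
    have hkk : k = k₀ := by
      have hmem : k ∈ (univ.filter fun k : Fin n => A k x = 1) := mem_filter.2 ⟨mem_univ _, hkA⟩
      rw [hk₀, mem_singleton] at hmem
      exact hmem
    subst hkk
    obtain ⟨hkp, hpk⟩ := hnear p (by rw [hp]; exact mem_singleton_self _)
    exact (cwt_gW_iff (by omega) P A r x hodd k hk₀ p hp hkp hpk).2 hrel
  have hcard := card_le_card hsub
  have hu1 := card_union_le ((SU ∪ SD) ∪ SN) SL
  have hu2 := card_union_le (SU ∪ SD) SN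
  have hu3 := card_union_le SU SD
  omega


end Window

end Summit.QuantumAdvantage.QuantumAdvantage.Theorems.AnchorDial

end
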